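import Summits.RiemannHypothesis.RiemannHypothesis.Theorems.PfPersistenceFfWeilCriterionSharpAllRoots

/-!
# Function-field mirror — sharpness of the positivity depth for EVERY genus (door D-D, part 2/2)

pub-rhpf campaign, function-field mirror seat 2 (separation analysis); mechanism/rigidity campaign —
**no RH claims**.  Companion of `PfPersistenceFfWeilCriterion` (the finite Weil criterion
`T_{2g-1}(q,h) ⪰ 0 ↔ RH(q,h)` for FE-honest data of degree `2g`) and of the kernel witnesses
`PfPersistenceFfWeilCriterionSharp` (`g = 2`), `…SharpG3/G4/G5` (`g = 3, 4, 5` at `q = 10⁴`).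

Here the per-`g` existential is settled for ALL `g` at once by an explicit two-parameter family:
for `g = g' + 1 ≥ 1` and `k ≥ max(1, 8g')` put `m = k(k+1)`, `q = m²` and
`h = (x - k²)(x - (k+1)²) · (x^{2g-1} - m^{2g-1})/(x - m)  ∈ ℤ[x]`
(`hAll g' k`; the last factor is `geomFactor m (2g')`).  Its roots are `k², (k+1)²` (a REAL reciprocal
pair OFF the circle `|α| = m`) and `m ζ^j`, `1 ≤ j ≤ 2g-2`, `ζ = e^{2πi/(2g-1)}` (on the circle), so the
normalised power sums are `s_d/m^d = r₊^d + r₋^d - 1` for `1 ≤ d ≤ 2g-2` (`r₊ = (k+1)/k = 1/r₋`), and the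
window form of depth `2g-2` is `T = ((2g-1)/2)·1 + ½·J + ½·(e(|i-j|))` with
`0 ≤ e(d) = r₊^d + r₋^d - 2 ≤ 1/3` on the window (Bernoulli: `(1+1/k)^{2g-2} ≤ 4/3` for `k ≥ 8(g-1)`),
whence `x*Tx ≥ ((2g-1)/3)|x|² ≥ 0`.  Depth `2g-1` fails by the criterion.  Main statements:
`sharp_witness_all` and the quantifier shape of record `positivityDepth_sharp :
∀ g ≥ 1, ∃ q h, FE-honest ∧ deg h = 2g ∧ ¬RH ∧ T_{2g-2} ⪰ 0 ∧ ¬ T_{2g-1} ⪰ 0`.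

Honest scope.  (i) `q = (k(k+1))²` is an integer but NOT a prime power (except `k = 1`, `q = 4`, the
`g = 2` witness of `…Sharp`); every door statement in this chain quantifies over real `q > 0` /
natural `q`, and an RH-false `h` is never the `L`-polynomial of a curve anyway (Weil), so the model class
is "FE-honest reciprocal integer polynomial with parameter `q`" throughout.  A prime-power variant
(`m = 2^t`, off-circle factor `x² - (2m+1)x + m²`) follows from the same estimate but is not formalised
here.  (ii) "FE-honest" is the root-side reading used by the criterion (roots closed under `α ↦ q/α`,
`0` not a root).  (iii) Nothing here bears on the number-field side.  All statements are exact
(`ℤ[x]`, cyclotomic and rational arithmetic); tags `[folklore]`.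
-/

set_option linter.dupNamespace false  -- the mandated namespace repeats `RiemannHypothesis`

noncomputable section

open Polynomial Matrix Finset
open scoped ComplexOrder ComplexConjugate

namespace Summit.RiemannHypothesis.RiemannHypothesis.Theorems.PfPersistence.FfAngleTwin

/-! ## Positivity of the window `2g' = 2g - 2` -/

/-- `(1 + t)^n ≤ 1/(1 - n t)` for `t ≥ 0`, `n t < 1`. [folklore] -/
theorem one_add_pow_le_inv {t : ℝ} (ht : 0 ≤ t) : ∀ n : ℕ, (n : ℝ) * t < 1 → (1 + t) ^ n ≤ 1 / (1 - n * t)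
  | 0 => by intro; simp
  | (n + 1) => by
      intro h
      push_cast at h ⊢
      have hn : (n : ℝ) * t < 1 := by nlinarith
      have ih := one_add_pow_le_inv ht n hn
      have hpos : 0 < 1 - (n : ℝ) * t := by linarith
      have hpos' : 0 < 1 - ((n : ℝ) + 1) * t := by linarith
      rw [pow_succ]
      calc (1 + t) ^ n * (1 + t) ≤ 1 / (1 - n * t) * (1 + t) := by gcongr
        _ ≤ 1 / (1 - (n + 1) * t) := by
          rw [div_mul_eq_mul_div, one_mul, div_le_div_iff₀ hpos hpos']
          nlinarith [sq_nonneg t]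

/-- `e(d) ≥ 0` (AM–GM, `r₊ r₋ = 1`). [folklore] -/
theorem eDev_nonneg {k : ℕ} (hk : k ≠ 0) (d : ℕ) : 0 ≤ eDev k d := by
  have hp : 0 < rPlus k := by
    have : (0 : ℝ) < k := by exact_mod_cast Nat.pos_of_ne_zero hk
    unfold rPlus; positivity
  have h1 : rPlus k ^ d * rMinus k ^ d = 1 := by rw [← mul_pow, rPlus_mul_rMinus hk, one_pow]
  have ha : 0 < rPlus k ^ d := pow_pos hp d
  unfold eDev
  nlinarith [sq_nonneg (rPlus k ^ d - 1)]

/-- For `k ≥ 8g'` the deviation is at most `1/3` on the whole window `d ≤ 2g'`. [folklore] -/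
theorem eDev_le {k g' d : ℕ} (hk : k ≠ 0) (hkg : 8 * g' ≤ k) (hd : d ≤ 2 * g') : eDev k d ≤ 1 / 3 := by
  have hk0 : (0 : ℝ) < k := by exact_mod_cast Nat.pos_of_ne_zero hk
  have hkg' : (8 : ℝ) * g' ≤ k := by exact_mod_cast hkg
  have hm1 : rMinus k ^ d ≤ 1 := by
    apply pow_le_one₀ (by unfold rMinus; positivity)
    rw [rMinus, div_le_one (by positivity)]; linarith
  have hp1 : 1 ≤ rPlus k := by rw [rPlus, le_div_iff₀ hk0]; linarith
  have ht : (0 : ℝ) ≤ 1 / k := by positivity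
  have hnt : ((2 * g' : ℕ) : ℝ) * (1 / k) < 1 := by
    rw [← div_eq_mul_one_div, div_lt_one hk0]; push_cast; linarith
  have hp2 : rPlus k ^ d ≤ 4 / 3 :=
    calc rPlus k ^ d ≤ rPlus k ^ (2 * g') := pow_le_pow_right₀ hp1 hd
      _ = (1 + 1 / k) ^ (2 * g') := by rw [rPlus]; field_simp
      _ ≤ 1 / (1 - ((2 * g' : ℕ) : ℝ) * (1 / k)) := one_add_pow_le_inv ht _ hnt
      _ ≤ 4 / 3 := by
        have hq : ((2 * g' : ℕ) : ℝ) * (1 / k) ≤ 1 / 4 := by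
          rw [← div_eq_mul_one_div, div_le_iff₀ hk0]; push_cast; linarith
        rw [div_le_div_iff₀ (by linarith) (by norm_num)]; linarith
  unfold eDev; linarith

/-- The real model is symmetric. [folklore] -/
theorem tEntry_symm (g' k : ℕ) (i j : Fin (2 * g' + 1)) : tEntry g' k j i = tEntry g' k i j := by
  unfold tEntry
  rw [Nat.dist_comm]
  by_cases h : i = j
  · subst h; rfl
  · rw [if_neg (Ne.symm h), if_neg h]

/-- `T_{2g-2} ⪰ 0` for the all-`g` witness, `k ≥ 8(g-1)`, `k ≥ 1`:
`x* T x = ((2g-1)/2)|x|² + ½|Σ x|² + ½ Σ e(|i-j|) Re( x̄_i x_j ) ≥ ((2g-1)/3)|x|² ≥ 0`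
since `0 ≤ e ≤ 1/3` on the window. [folklore] -/
theorem windowForm_all_posSemidef (g' : ℕ) {k : ℕ} (hk : k ≠ 0) (hkg : 8 * g' ≤ k) :
    (ffWindowForm (qAll k : ℝ) (rootsAll g' k) (2 * g')).PosSemidef := by
  refine Matrix.PosSemidef.of_dotProduct_mulVec_nonneg ?_ ?_
  · refine Matrix.IsHermitian.ext fun i j => ?_
    rw [windowForm_all_apply g' hk, windowForm_all_apply g' hk, tEntry_symm, Complex.star_def,
      Complex.conj_ofReal]
  intro x
  have he_symm : ∀ i j : Fin (2 * g' + 1), eDev k (Nat.dist j i) = eDev k (Nat.dist i j) :=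
    fun i j => by rw [Nat.dist_comm]
  have he0 : ∀ i j : Fin (2 * g' + 1), 0 ≤ eDev k (Nat.dist i j) := fun i j => eDev_nonneg hk _
  have he1 : ∀ i j : Fin (2 * g' + 1), eDev k (Nat.dist i j) ≤ 1 / 3 := fun i j => eDev_le hk hkg (by
    have hi := i.isLt; have hj := j.isLt; unfold Nat.dist; omega)
  -- Step A: expand the quadratic form through the real model of the entries.
  have hQ : star x ⬝ᵥ (ffWindowForm (qAll k : ℝ) (rootsAll g' k) (2 * g') *ᵥ x) =
      (2 * g' + 1) / 2 * (∑ i, conj (x i) * x i) + (∑ i, conj (x i)) * (∑ j, x j) / 2 +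
        (∑ i : Fin (2 * g' + 1), ∑ j : Fin (2 * g' + 1), (eDev k (Nat.dist i j) : ℂ) * (conj (x i) * x j)) / 2 := by
    have hterm : ∀ i j : Fin (2 * g' + 1),
        star (x i) * (ffWindowForm (qAll k : ℝ) (rootsAll g' k) (2 * g') i j * x j) =
          (2 * g' + 1) / 2 * (if i = j then conj (x i) * x j else 0) + conj (x i) * x j / 2 +
            (eDev k (Nat.dist i j) : ℂ) * (conj (x i) * x j) / 2 := by
      intro i j
      rw [windowForm_all_apply g' hk, tEntry, Complex.star_def]
      by_cases hij : i = j
      · rw [if_pos hij, if_pos hij]; push_cast; ring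
      · rw [if_neg hij, if_neg hij]; push_cast; ring
    have step1 : star x ⬝ᵥ (ffWindowForm (qAll k : ℝ) (rootsAll g' k) (2 * g') *ᵥ x) =
        ∑ i, ∑ j, star (x i) * (ffWindowForm (qAll k : ℝ) (rootsAll g' k) (2 * g') i j * x j) := by
      simp only [dotProduct, Matrix.mulVec, Pi.star_apply]
      exact Finset.sum_congr rfl fun i _ => by rw [Finset.mul_sum]
    have hA : ∑ i : Fin (2 * g' + 1), ∑ j, (2 * (g' : ℂ) + 1) / 2 * (if i = j then conj (x i) * x j else 0) =
        (2 * g' + 1) / 2 * ∑ i, conj (x i) * x i := by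
      rw [Finset.mul_sum]
      refine Finset.sum_congr rfl fun i _ => ?_
      rw [← Finset.mul_sum, Finset.sum_ite_eq]
      simp
    have hB : ∑ i : Fin (2 * g' + 1), ∑ j, conj (x i) * x j / 2 = (∑ i, conj (x i)) * (∑ j, x j) / 2 := by
      rw [Finset.sum_mul_sum, Finset.sum_div]
      exact Finset.sum_congr rfl fun i _ => by rw [Finset.sum_div]
    have hC : ∑ i : Fin (2 * g' + 1), ∑ j : Fin (2 * g' + 1), (eDev k (Nat.dist i j) : ℂ) * (conj (x i) * x j) / 2 =
        (∑ i : Fin (2 * g' + 1), ∑ j : Fin (2 * g' + 1), (eDev k (Nat.dist i j) : ℂ) * (conj (x i) * x j)) / 2 := by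
      rw [Finset.sum_div]
      exact Finset.sum_congr rfl fun i _ => by rw [Finset.sum_div]
    rw [step1, Finset.sum_congr rfl fun i _ => Finset.sum_congr rfl fun j _ => hterm i j]
    simp only [Finset.sum_add_distrib]
    rw [hA, hB, hC]
  -- Step B: each piece is real.
  have hP1 : (∑ i, conj (x i) * x i) = ((∑ i, ‖x i‖ ^ 2 : ℝ) : ℂ) := by
    push_cast
    exact Finset.sum_congr rfl fun i _ => Complex.conj_mul' (x i)
  have hP2 : (∑ i, conj (x i)) * (∑ j, x j) = ((‖∑ i, x i‖ ^ 2 : ℝ) : ℂ) := by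
    rw [← map_sum, Complex.conj_mul']
    push_cast; rfl
  have hswap : (∑ i : Fin (2 * g' + 1), ∑ j : Fin (2 * g' + 1), (eDev k (Nat.dist i j) : ℂ) * (conj (x i) * x j)) =
      ∑ i : Fin (2 * g' + 1), ∑ j : Fin (2 * g' + 1), (eDev k (Nat.dist i j) : ℂ) * conj (conj (x i) * x j) := by
    rw [Finset.sum_comm]
    refine Finset.sum_congr rfl fun i _ => Finset.sum_congr rfl fun j _ => ?_
    rw [map_mul, Complex.conj_conj, he_symm i j, mul_comm (x i)]
  have hP3 : (∑ i : Fin (2 * g' + 1), ∑ j : Fin (2 * g' + 1), (eDev k (Nat.dist i j) : ℂ) * (conj (x i) * x j)) =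
      ((∑ i : Fin (2 * g' + 1), ∑ j : Fin (2 * g' + 1), eDev k (Nat.dist i j) * (conj (x i) * x j).re : ℝ) : ℂ) := by
    rw [show (∑ i : Fin (2 * g' + 1), ∑ j : Fin (2 * g' + 1), (eDev k (Nat.dist i j) : ℂ) * (conj (x i) * x j)) =
        ((∑ i : Fin (2 * g' + 1), ∑ j : Fin (2 * g' + 1), (eDev k (Nat.dist i j) : ℂ) * (conj (x i) * x j)) + ∑ i : Fin (2 * g' + 1), ∑ j : Fin (2 * g' + 1), (eDev k (Nat.dist i j) : ℂ) * conj (conj (x i) * x j)) / 2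
        from by rw [← hswap]; ring]
    rw [← Finset.sum_add_distrib]
    push_cast
    rw [Finset.sum_div]
    refine Finset.sum_congr rfl fun i _ => ?_
    rw [← Finset.sum_add_distrib, Finset.sum_div]
    refine Finset.sum_congr rfl fun j _ => ?_
    rw [← mul_add, Complex.add_conj]
    push_cast
    ring
  -- Step C: the real lower bound.
  have hre : ∀ i j, -(‖x i‖ * ‖x j‖) ≤ (conj (x i) * x j).re := by
    intro i j
    have h := (abs_le.1 (Complex.abs_re_le_norm (conj (x i) * x j))).1
    rwa [norm_mul, Complex.norm_conj] at h
  have hterm : ∀ i j, -(1 / 3) * (‖x i‖ * ‖x j‖) ≤ eDev k (Nat.dist i j) * (conj (x i) * x j).re := by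
    intro i j
    have h1 := hre i j
    have h2 := he0 i j
    have h3 := he1 i j
    have h4 : 0 ≤ ‖x i‖ * ‖x j‖ := by positivity
    nlinarith
  have hP3le : -(1 / 3) * ((2 * g' + 1) * ∑ i, ‖x i‖ ^ 2) ≤ ∑ i : Fin (2 * g' + 1), ∑ j : Fin (2 * g' + 1), eDev k (Nat.dist i j) * (conj (x i) * x j).re := by
    have hcs : (∑ i : Fin (2 * g' + 1), ‖x i‖) ^ 2 ≤ (2 * g' + 1) * ∑ i, ‖x i‖ ^ 2 := by
      have := sq_sum_le_card_mul_sum_sq (s := Finset.univ) (f := fun i : Fin (2 * g' + 1) => ‖x i‖)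
      simpa [Finset.card_univ, Fintype.card_fin] using this
    calc -(1 / 3) * ((2 * g' + 1) * ∑ i, ‖x i‖ ^ 2)
        ≤ -(1 / 3) * (∑ i : Fin (2 * g' + 1), ‖x i‖) ^ 2 := by nlinarith
      _ = ∑ i, ∑ j, -(1 / 3) * (‖x i‖ * ‖x j‖) := by
          rw [sq, Finset.sum_mul_sum, Finset.mul_sum]
          exact Finset.sum_congr rfl fun i _ => by rw [Finset.mul_sum]
      _ ≤ ∑ i : Fin (2 * g' + 1), ∑ j : Fin (2 * g' + 1), eDev k (Nat.dist i j) * (conj (x i) * x j).re :=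
          Finset.sum_le_sum fun i _ => Finset.sum_le_sum fun j _ => hterm i j
  have hsq : 0 ≤ ‖∑ i, x i‖ ^ 2 := by positivity
  have hA : 0 ≤ ∑ i : Fin (2 * g' + 1), ‖x i‖ ^ 2 := Finset.sum_nonneg fun i _ => by positivity
  rw [hQ, hP1, hP2, hP3]
  have hreal : ((2 * g' + 1) / 2 * (((∑ i, ‖x i‖ ^ 2 : ℝ)) : ℂ) + ((‖∑ i, x i‖ ^ 2 : ℝ) : ℂ) / 2 +
      ((∑ i : Fin (2 * g' + 1), ∑ j : Fin (2 * g' + 1), eDev k (Nat.dist i j) * (conj (x i) * x j).re : ℝ) : ℂ) / 2 : ℂ) =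
      (((2 * g' + 1) / 2 * (∑ i, ‖x i‖ ^ 2) + ‖∑ i, x i‖ ^ 2 / 2 +
        (∑ i : Fin (2 * g' + 1), ∑ j : Fin (2 * g' + 1), eDev k (Nat.dist i j) * (conj (x i) * x j).re) / 2 : ℝ) : ℂ) := by
    push_cast; ring
  rw [hreal]
  exact Complex.zero_le_real.2 (by nlinarith)

/-! ## The all-`g` sharpness theorem -/

/-- `q > 0` for `k ≥ 1`. [folklore] -/
theorem qAll_pos {k : ℕ} (hk : k ≠ 0) : 0 < qAll k :=
  pow_pos (Nat.mul_pos (Nat.pos_of_ne_zero hk) (Nat.succ_pos k)) 2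

/-- `q = (k(k+1))²` as a complex number. [folklore] -/
theorem qAll_cast (k : ℕ) : ((qAll k : ℝ) : ℂ) = ((k * (k + 1) : ℕ) : ℂ) ^ 2 := by
  push_cast [qAll]; ring

/-- ALL-`g` SHARPNESS OF THE POSITIVITY DEPTH (door D-D; pub-rhpf ESCAPE-DOORS v1.17, ADJ-LOG A263/A290):
for every `g = g' + 1 ≥ 1` and every `k ≥ max(1, 8g')`, the datum `(q, h) = ((k(k+1))², hAll g' k)` is
FE-honest (roots closed under `α ↦ q/α`, `h(0) ≠ 0`), has degree `2g`, VIOLATES the function-field RH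
(root `(k+1)²` of modulus `≠ √q = k(k+1)`), and yet its window form of depth `2g - 2` is positive
semidefinite — while depth `2g - 1` fails, as it must by the finite Weil criterion.  So the depth `2g - 1`
in `weilWindowForm_posSemidef_twoG_iff` cannot be lowered, for ANY `g`. [folklore] -/
theorem sharp_witness_all (g' : ℕ) {k : ℕ} (hk : k ≠ 0) (hkg : 8 * g' ≤ k) :
    (frobRoots (hAll g' k)).map (fun α => ((qAll k : ℝ) : ℂ) / α) = frobRoots (hAll g' k) ∧
    (0 : ℂ) ∉ frobRoots (hAll g' k) ∧ (hAll g' k).natDegree = 2 * (g' + 1) ∧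
    ¬ (∀ α ∈ frobRoots (hAll g' k), ‖α‖ = Real.sqrt (qAll k : ℝ)) ∧
    (weilWindowForm (qAll k : ℝ) (hAll g' k) (2 * g')).PosSemidef ∧
    ¬ (weilWindowForm (qAll k : ℝ) (hAll g' k) (2 * g' + 1)).PosSemidef := by
  have hrec : (frobRoots (hAll g' k)).map (fun α => ((qAll k : ℝ) : ℂ) / α) = frobRoots (hAll g' k) := by
    rw [frobRoots_hAll, qAll_cast]
    exact rootsAll_reciprocal g' hk
  have h0 : (0 : ℂ) ∉ frobRoots (hAll g' k) := by rw [frobRoots_hAll]; exact zero_not_mem_rootsAll g' hk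
  have hnot : ¬ (∀ α ∈ frobRoots (hAll g' k), ‖α‖ = Real.sqrt (qAll k : ℝ)) := by
    rw [frobRoots_hAll]; exact not_rh_rootsAll g' k
  have hq : (0 : ℝ) < (qAll k : ℝ) := by exact_mod_cast qAll_pos hk
  refine ⟨hrec, h0, natDegree_hAll g' k, hnot, ?_, ?_⟩
  · rw [weilWindowForm, frobRoots_hAll]; exact windowForm_all_posSemidef g' hk hkg
  · exact weilWindowForm_not_posSemidef_of_offCircle hq hrec h0
      (by push Not at hnot; exact hnot) (by rw [natDegree_hAll]; omega)

/-- COROLLARY (the quantifier shape of record): for EVERY `g ≥ 1` there is an FE-honest, RH-false datum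
of degree `2g` whose window forms are positive semidefinite up to depth `2g - 2` — one step short of the
deciding depth `2g - 1`.  (`q = (k(k+1))²` with `k = 8g - 7`.) [folklore] -/
theorem positivityDepth_sharp (g : ℕ) (hg : 1 ≤ g) :
    ∃ (q : ℕ) (h : ℤ[X]), 0 < q ∧
      (frobRoots h).map (fun α => ((q : ℝ) : ℂ) / α) = frobRoots h ∧ (0 : ℂ) ∉ frobRoots h ∧
      h.natDegree = 2 * g ∧ ¬ (∀ α ∈ frobRoots h, ‖α‖ = Real.sqrt q) ∧
      (weilWindowForm q h (2 * g - 2)).PosSemidef ∧ ¬ (weilWindowForm q h (2 * g - 1)).PosSemidef := by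
  obtain ⟨g', rfl⟩ : ∃ g', g = g' + 1 := ⟨g - 1, by omega⟩
  have hk : 8 * g' + 1 ≠ 0 := Nat.succ_ne_zero _
  obtain ⟨h1, h2, h3, h4, h5, h6⟩ := sharp_witness_all g' hk (Nat.le_succ _)
  refine ⟨qAll (8 * g' + 1), hAll g' (8 * g' + 1), qAll_pos hk, h1, h2, h3, h4, ?_, ?_⟩
  · rw [show 2 * (g' + 1) - 2 = 2 * g' by omega]; exact h5
  · rw [show 2 * (g' + 1) - 1 = 2 * g' + 1 by omega]; exact h6

end Summit.RiemannHypothesis.RiemannHypothesis.Theorems.PfPersistence.FfAngleTwin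

end
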